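import Literature.MathematicalPhysics.QuantumFieldTheory.Balaban1983to89.B7Prop2Explicit
import Literature.MathematicalPhysics.QuantumFieldTheory.Balaban1983to89.B7BlockAvgLog
import Literature.MathematicalPhysics.QuantumFieldTheory.Balaban1983to89.MatrixLog
import Summits.QuantumFields.Balaban3D.Proofs.GroupModelSkew
import Summits.QuantumFields.Balaban3D.Proofs.LiftBridge

/-!
# Route «BalabanUVNodes», Track-A DAG node N08 = [Balaban1985UV3] — (α) clause, the in-edge sentence (b11‴) CONSTRUCTED, part 1:
# ABELIAN ONE-PARAMETER-SUBGROUP CONFIGURATIONS and the averaging (42) ON THEM (exact linear form)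

Cell `pub-ymgap`, seat `pub-ymgap-dag-n08-d` gen 5 (director-ym R134 row «CLASS-I in-edge conclusions at the (α) granularity of `RunAlpha`»), file F1.
`bears_on: R4∕N08`; filed `--supports stmt-QuantumFields-19910 --as helper`.  Sorry-free, standard axioms.

THE POINT.  Gen 4 reduced the in-edge side of the (α) clause to ONE kinematic sentence (b11‴, `…N08AlphaProfile`): every admissible history `h` is
EXHIBITED by a configuration of [7]'s closed regular class whose lifted `j`-fold averages (42)–(43) of [4] are `h`-LARGE on `Λ_j(h)`.  Gen 5 constructs
such profiles.  The construction is ABELIAN: for a fixed element `X` of the Lie algebra `𝔤` of the group as printed (`GroupModel.lie`,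
`GroupModel.mem_lie_iff`: `exp(tX) ∈ ρ(G)` for all real `t`) and a REAL lattice one-form `a`, the configuration `abelCfg X a : (x, κ) ↦ exp(a(x, κ)·X)`
takes values in the one-parameter subgroup `{exp(tX)}`, on which everything commutes; then
* parallel transport (9) is `exp(A(Γ)·X)` with `A(Γ) = Σ_{b⊂Γ} ±a_b` the tree's abelian path functional `B7Prop1Explicit.asum` (`hol_abelCfg`);
* the `log`-argument of (42), `V(Γ_{c,x})V(c)⁻¹`, is `exp(Φ·X)` with `Φ` the flux `A(Γ_{c,x}) − A(c)` (`Wcx_abelCfg`), and where `|Φ|·‖X‖ < log 2` the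
  series (21) inverts the exponential (`B7BlockAvgLog.mlog_exp`), so that
* the one-step average (42) of `abelCfg X a` at such a bond IS `abelCfg X (linAvg L a)` — the exponential of the LINEAR block average
  `(linAvg L a)(c) = L^{−d} Σ_{x∈B(c₋)} A(Γ_{c,x})` of [4] (14) (`bavg_abelCfg`);
* for matrices and `X ∈ 𝔤` (skew-Hermitian, `GroupModelSkew.conjTranspose_eq_neg_of_mem_lie`): `(2/π)|t|‖X‖ ≤ ‖exp(tX) − 1‖ ≤ |t|‖X‖` (the second for
  `|t|‖X‖ ≤ π`; tree `MatrixLog.opDist1_exp_le`, `norm_le_pi_div_two_mul_opDist1_exp`);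
* the torus configuration `gexpCfg 𝔊 hX a : b ↦ (the element of G over exp(a(b)X))` lifts to `abelCfg X (a ∘ proj)` (`liftCfg_gexpCfg`) and its plaquette
  variables are `exp((curl a)·X)` (`rho_plaqHol_gexpCfg`).
Files F2–F5 iterate (43), build the staggered curvature patterns and the blended profile of a history, F6–F7 run the END.
HONEST FRAMING: kernel bookkeeping over [4]'s definitions (`B7Prop1Explicit`, `B7Prop2Explicit`) for TEST configurations; nothing of [B10] ∕ [7] ∕ [4]'s
estimates is asserted; count-neutral; NOT a discharge of N08.  d = 3 lattice gauge theory on finite tori as printed; nothing about d = 4, the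
continuum, OS axioms, a mass gap or the Clay problem.
-/

noncomputable section

namespace Summit.QuantumFields.YangMills.Theorems.BalabanUVNodesN08AlphaAbelianLift

open scoped BigOperators Matrix.Norms.L2Operator
open NormedSpace
open Literature.MathematicalPhysics.QuantumFieldTheory.Balaban1983to89
open Literature.MathematicalPhysics.QuantumFieldTheory.Balaban1985CMP102.Setting
open Summit.QuantumFields.Balaban3D.Proofs.LiftBridge (liftCfg)
open Summit.QuantumFields.Balaban3D.Proofs.TorusLift (projSite)
open Summit.QuantumFields.Balaban3D.Proofs.GroupModelSkew (conjTranspose_eq_neg_of_mem_lie)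
open B7Prop1Explicit

/-! ## §1 Abelian configurations in a complete normed algebra and their parallel transport -/

section Algebra

variable {d : ℕ} {𝔸 : Type*} [NormedRing 𝔸] [NormedAlgebra ℂ 𝔸] [CompleteSpace 𝔸]

/-- **THE ABELIAN CONFIGURATION** of a real lattice one-form `a` along a fixed algebra element `X`: `(x, κ) ↦ exp(a(x, κ)·X)` (a unit).
[cite: Balaban1985Averaging, (3) p.18 + (22) p.21] -/
def abelCfg (X : 𝔸) (a : Site d → Fin d → ℝ) : Site d → Fin d → 𝔸ˣ :=
  fun x κ => expUnit (((a x κ : ℝ) : ℂ) • X)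

/-- The value of the abelian configuration. [folklore] -/
@[simp] theorem val_abelCfg (X : 𝔸) (a : Site d → Fin d → ℝ) (x : Site d) (κ : Fin d) :
    ((abelCfg X a x κ : 𝔸ˣ) : 𝔸) = exp (((a x κ : ℝ) : ℂ) • X) := rfl

omit [CompleteSpace 𝔸] in
/-- Real multiples of one element commute. [folklore] -/
theorem commute_real_smul (X : 𝔸) (s t : ℝ) : Commute (((s : ℝ) : ℂ) • X) (((t : ℝ) : ℂ) • X) :=
  ((Commute.refl X).smul_left _).smul_right _

/-- **One-parameter subgroup law**: `exp(sX)·exp(tX) = exp((s+t)X)` (as units). [folklore] -/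
theorem expUnit_smul_mul_expUnit_smul (X : 𝔸) (s t : ℝ) :
    expUnit (((s : ℝ) : ℂ) • X) * expUnit (((t : ℝ) : ℂ) • X) = expUnit ((((s + t : ℝ)) : ℂ) • X) := by
  ext
  letI : NormedAlgebra ℚ 𝔸 := NormedAlgebra.restrictScalars ℚ ℂ 𝔸
  simp only [Units.val_mul, val_expUnit]
  rw [Complex.ofReal_add, add_smul, exp_add_of_commute (commute_real_smul X s t)]

/-- `exp(tX)⁻¹ = exp((−t)X)` (as units). [folklore] -/
theorem inv_expUnit_smul (X : 𝔸) (t : ℝ) :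
    (expUnit (((t : ℝ) : ℂ) • X))⁻¹ = expUnit ((((-t : ℝ)) : ℂ) • X) := by
  rw [val_inv_expUnit, Complex.ofReal_neg, neg_smul]

/-- `exp(0·X) = 1` (as units). [folklore] -/
theorem expUnit_zero_smul (X : 𝔸) : expUnit ((((0 : ℝ)) : ℂ) • X) = 1 := by
  ext
  simp only [val_expUnit, Complex.ofReal_zero, zero_smul, exp_zero, Units.val_one]

/-- One letter of an abelian configuration: `V(±b) = exp(±a_b·X)`. [cite: Balaban1985Averaging, (9) p.18] -/
theorem stepHol_abelCfg (X : 𝔸) (a : Site d → Fin d → ℝ) (x : Site d) (l : Letter d) :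
    stepHol (abelCfg X a) x l = expUnit (((stepA a x l : ℝ) : ℂ) • X) := by
  obtain ⟨μ, b⟩ := l
  cases b
  · rw [stepHol_false, stepA_false, show x - e μ = x + Letter.vec ((μ, false) : Letter d) - 0 by simp [sub_eq_add_neg]]
    simp only [sub_zero, abelCfg, inv_expUnit_smul]
  · rfl

/-- **PARALLEL TRANSPORT (9) OF AN ABELIAN CONFIGURATION IS THE EXPONENTIAL OF THE ABELIAN PATH FUNCTIONAL**: `V(Γ) = exp(A(Γ)·X)`,
`A(Γ) = Σ_{b ⊂ Γ} ±a_b` (`B7Prop1Explicit.asum`). [cite: Balaban1985Averaging, (9) p.18 + p.24] -/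
theorem hol_abelCfg (X : 𝔸) (a : Site d → Fin d → ℝ) :
    ∀ (w : List (Letter d)) (x : Site d), hol (abelCfg X a) x w = expUnit (((asum a x w : ℝ) : ℂ) • X)
  | [], x => by rw [hol_nil, asum_nil, expUnit_zero_smul]
  | l :: w, x => by
    rw [hol_cons, asum_cons, hol_abelCfg X a w (x + l.vec), stepHol_abelCfg, expUnit_smul_mul_expUnit_smul]

/-! ## §2 The `log`-argument of (42) and the linear block average -/

variable (L : ℕ)

/-- **THE FLUX OF THE CONTOUR `Γ_{c,x} ∪ (−c)`**: `A(Γ_{c,x}) − A(c)` for the `L`-bond `c = ⟨q, q + Le_κ⟩` and `x = q + r`.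
[cite: Balaban1985Averaging, (42) p.23 + (48) p.25] -/
def wflux (a : Site d → Fin d → ℝ) (q : Site d) (κ : Fin d) (r : Site d) : ℝ :=
  asum a q (gammaWord L κ r) - asum a q (seg κ L)

/-- **THE LINEAR BLOCK AVERAGE** of [4] (14) ∕ B5 (1.8): `(linAvg L a)(q, κ) = L^{−d} Σ_{x ∈ B(c₋)} A(Γ_{c,x})`, `c = ⟨q, q + Le_κ⟩` — a real one-form
on the `L`-lattice bonds, indexed like `bavg`. [cite: Balaban1985Averaging, (14) p.19] -/
def linAvg (a : Site d → Fin d → ℝ) : Site d → Fin d → ℝ := fun q κ =>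
  ((L : ℝ) ^ d)⁻¹ * ∑ r : Fin d → Fin L, asum a q (gammaWord L κ (boxVec L r))

/-- **`V(Γ_{c,x})V(c)⁻¹ = exp(Φ·X)`** for an abelian configuration, `Φ` the contour flux. [cite: Balaban1985Averaging, (42) p.23] -/
theorem Wcx_abelCfg (X : 𝔸) (a : Site d → Fin d → ℝ) (q : Site d) (κ : Fin d) (r : Site d) :
    Wcx L (abelCfg X a) q κ r = expUnit (((wflux L a q κ r : ℝ) : ℂ) • X) := by
  unfold Wcx wflux
  rw [hol_abelCfg, hol_abelCfg, inv_expUnit_smul, expUnit_smul_mul_expUnit_smul, sub_eq_add_neg]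

omit [CompleteSpace 𝔸] in
/-- Norm of a real multiple. [folklore] -/
theorem norm_real_smul (t : ℝ) (X : 𝔸) : ‖(((t : ℝ) : ℂ) • X)‖ = |t| * ‖X‖ := by
  rw [norm_smul, Complex.norm_real, Real.norm_eq_abs]

/-- **`log exp(tX) = tX` for `|t|‖X‖ < log 2`** (the series (21); tree `B7BlockAvgLog.mlog_exp`). [cite: Balaban1985Averaging, (21) p.21] -/
theorem mlog_exp_real_smul {t : ℝ} {X : 𝔸} (h : |t| * ‖X‖ < Real.log 2) :
    MatrixLog.mlog (exp (((t : ℝ) : ℂ) • X)) = ((t : ℝ) : ℂ) • X :=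
  B7BlockAvgLog.mlog_exp (by rwa [norm_real_smul])

omit [CompleteSpace 𝔸] in
/-- A real scalar acting on a complex multiple: `s • (z • X) = (s·z) • X`. [folklore] -/
theorem real_smul_complex_smul (s : ℝ) (z : ℂ) (X : 𝔸) : s • (z • X) = (((s : ℝ) : ℂ) * z) • X := by
  rw [mul_smul, Complex.coe_smul]

/-- **THE EXPONENT OF (42) ON AN ABELIAN CONFIGURATION**: where every contour flux at the bond satisfies `|Φ|‖X‖ < log 2`,
`X_c = (linAvg L a (c) − A(c))·X`. [cite: Balaban1985Averaging, (42) p.23 + (14) p.19] -/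
theorem Xavg_abelCfg (hL : L ≠ 0) (X : 𝔸) (a : Site d → Fin d → ℝ) (q : Site d) (κ : Fin d)
    (h : ∀ r : Fin d → Fin L, |wflux L a q κ (boxVec L r)| * ‖X‖ < Real.log 2) :
    Xavg L (abelCfg X a) q κ = (((linAvg L a q κ - asum a q (seg κ L) : ℝ)) : ℂ) • X := by
  unfold Xavg
  have hterm : ∀ r : Fin d → Fin L, (((L : ℝ) ^ d)⁻¹) • MatrixLog.mlog ((Wcx L (abelCfg X a) q κ (boxVec L r) : 𝔸ˣ) : 𝔸)
      = (((((L : ℝ) ^ d)⁻¹ * wflux L a q κ (boxVec L r) : ℝ)) : ℂ) • X := by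
    intro r
    rw [Wcx_abelCfg, val_expUnit, mlog_exp_real_smul (h r), real_smul_complex_smul, ← Complex.ofReal_mul]
  rw [Finset.sum_congr rfl fun r _ => hterm r, ← Finset.sum_smul, ← Complex.ofReal_sum]
  congr 2
  have hcard : (Finset.univ : Finset (Fin d → Fin L)).card = L ^ d := by
    rw [Finset.card_univ, Fintype.card_fun, Fintype.card_fin, Fintype.card_fin]
  have hLd : ((L : ℝ) ^ d) ≠ 0 := pow_ne_zero _ (Nat.cast_ne_zero.2 hL)
  simp only [wflux, mul_sub, Finset.sum_sub_distrib, Finset.sum_const, hcard, nsmul_eq_mul, Nat.cast_pow]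
  rw [linAvg, Finset.mul_sum]
  field_simp

/-- **THE ONE-STEP AVERAGE (42) OF AN ABELIAN CONFIGURATION IS THE ABELIAN CONFIGURATION OF ITS LINEAR BLOCK AVERAGE** — at every `L`-bond whose
`L^d` contour fluxes satisfy `|Φ|‖X‖ < log 2`: `V̄_c = exp[(X_c)]·V(c) = exp((linAvg L a)(c)·X)`. [cite: Balaban1985Averaging, (42) p.23 + (14) p.19] -/
theorem bavg_abelCfg (hL : L ≠ 0) (X : 𝔸) (a : Site d → Fin d → ℝ) (q : Site d) (κ : Fin d)
    (h : ∀ r : Fin d → Fin L, |wflux L a q κ (boxVec L r)| * ‖X‖ < Real.log 2) :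
    bavg L (abelCfg X a) q κ = abelCfg X (linAvg L a) q κ := by
  unfold bavg
  rw [Xavg_abelCfg L hL X a q κ h, hol_abelCfg]
  show expUnit _ * expUnit _ = expUnit _
  rw [expUnit_smul_mul_expUnit_smul, sub_add_cancel]

/-- `‖exp(Φ·X) − 1‖ ≤ exp(|Φ|‖X‖) − 1` in any complete normed algebra (crude; the unitary refinement is §3). [folklore] -/
theorem norm_val_Wcx_abelCfg_sub_one_le (X : 𝔸) (a : Site d → Fin d → ℝ) (q : Site d) (κ : Fin d) (r : Site d) :
    ‖((Wcx L (abelCfg X a) q κ r : 𝔸ˣ) : 𝔸) - 1‖ ≤ Real.exp (|wflux L a q κ r| * ‖X‖) - 1 := by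
  rw [Wcx_abelCfg, val_expUnit, ← norm_real_smul]
  exact (norm_exp_sub_one_le_of_norm_le le_rfl).1

end Algebra

/-! ## §3 Matrices: the unitary one-parameter subgroups of `𝔤` and the two-sided bound `(2/π)|t|‖X‖ ≤ ‖exp(tX) − 1‖ ≤ |t|‖X‖` -/

section Matrices

variable {N : ℕ}

/-- For skew-Hermitian `X`, `−iX` is Hermitian. [folklore] -/
theorem isHermitian_neg_I_smul {X : Matrix (Fin N) (Fin N) ℂ} (hX : X.conjTranspose = -X) :
    (-(Complex.I • X)).IsHermitian := by
  unfold Matrix.IsHermitian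
  rw [Matrix.conjTranspose_neg, Matrix.conjTranspose_smul, hX, Complex.star_def, Complex.conj_I]
  simp [smul_neg, neg_smul]

/-- `tX = i·(t·(−iX))`. [folklore] -/
theorem real_smul_eq_I_smul {X : Matrix (Fin N) (Fin N) ℂ} (t : ℝ) :
    ((t : ℝ) : ℂ) • X = Complex.I • (((t : ℝ) : ℂ) • (-(Complex.I • X))) := by
  symm
  rw [smul_neg, smul_neg, smul_smul, smul_smul, show Complex.I * (t : ℂ) * Complex.I = -(t : ℂ) by
    rw [mul_right_comm, Complex.I_mul_I, neg_one_mul], neg_smul, neg_neg]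

/-- For skew-Hermitian `X` and real `t`, `t·(−iX)` is Hermitian. [folklore] -/
theorem isHermitian_real_smul_neg_I_smul {X : Matrix (Fin N) (Fin N) ℂ} (hX : X.conjTranspose = -X) (t : ℝ) :
    (((t : ℝ) : ℂ) • (-(Complex.I • X))).IsHermitian := by
  unfold Matrix.IsHermitian
  rw [Matrix.conjTranspose_smul, (isHermitian_neg_I_smul hX).eq, Complex.star_def, Complex.conj_ofReal]

/-- `‖t·(−iX)‖ = |t|‖X‖`. [folklore] -/
theorem norm_real_smul_neg_I_smul {X : Matrix (Fin N) (Fin N) ℂ} (t : ℝ) :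
    ‖((t : ℝ) : ℂ) • (-(Complex.I • X))‖ = |t| * ‖X‖ := by
  rw [norm_smul, norm_neg, norm_smul, Complex.norm_I, one_mul, Complex.norm_real, Real.norm_eq_abs]

/-- **UPPER BOUND `‖exp(tX) − 1‖ ≤ |t|‖X‖` for skew-Hermitian `X`** ([4] (24) via `MatrixLog.opDist1_exp_le`). [cite: Balaban1985Averaging, (24) p.21] -/
theorem norm_exp_real_smul_sub_one_le {X : Matrix (Fin N) (Fin N) ℂ} (hX : X.conjTranspose = -X) (t : ℝ) :
    ‖exp (((t : ℝ) : ℂ) • X) - 1‖ ≤ |t| * ‖X‖ := by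
  have h := MatrixLog.opDist1_exp_le (isHermitian_real_smul_neg_I_smul hX t)
  rw [UnitaryModel.opDist1, ← real_smul_eq_I_smul, norm_real_smul_neg_I_smul] at h
  exact h

/-- **LOWER BOUND `|t|‖X‖ ≤ (π/2)‖exp(tX) − 1‖` for skew-Hermitian `X` and `|t|‖X‖ ≤ π`** ([4] (25) via
`MatrixLog.norm_le_pi_div_two_mul_opDist1_exp`). [cite: Balaban1985Averaging, (25) p.21] -/
theorem abs_mul_norm_le_of_exp {X : Matrix (Fin N) (Fin N) ℂ} (hX : X.conjTranspose = -X) {t : ℝ} (hπ : |t| * ‖X‖ ≤ Real.pi) :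
    |t| * ‖X‖ ≤ Real.pi / 2 * ‖exp (((t : ℝ) : ℂ) • X) - 1‖ := by
  have h := MatrixLog.norm_le_pi_div_two_mul_opDist1_exp (isHermitian_real_smul_neg_I_smul hX t)
    (by rwa [norm_real_smul_neg_I_smul])
  rw [UnitaryModel.opDist1, ← real_smul_eq_I_smul, norm_real_smul_neg_I_smul] at h
  exact h

end Matrices

/-! ## §4 The group as printed: the one-parameter subgroup over `exp(tX)`, `X ∈ 𝔤`, and the torus configurations of a real one-form -/

section Group

variable {L : ℕ} {S : Scales L} {G : Type} [GaugeGroup G] [MeasurableSpace G] (𝔊 : GroupModel G)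

/-- **THE ELEMENT OF `G` OVER `exp(tX)`** for `X ∈ 𝔤` (`GroupModel.mem_lie_iff`: `exp(tX) ∈ ρ(G)` for every real `t`; unique since `ρ` is faithful).
[cite: Balaban1985UV3, Thm 1 p.257 (the group as printed)] -/
def gexp {X : Matrix (Fin 𝔊.N) (Fin 𝔊.N) ℂ} (hX : X ∈ 𝔊.lie) (t : ℝ) : G :=
  Classical.choose ((𝔊.mem_lie_iff X).1 hX t)

/-- `ρ(gexp t) = exp(tX)`. [folklore] -/
theorem rho_gexp {X : Matrix (Fin 𝔊.N) (Fin 𝔊.N) ℂ} (hX : X ∈ 𝔊.lie) (t : ℝ) : 𝔊.ρ (gexp 𝔊 hX t) = exp (((t : ℝ) : ℂ) • X) :=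
  Classical.choose_spec ((𝔊.mem_lie_iff X).1 hX t)

/-- `ρ(gexp t)` as a unit is `expUnit(tX)`. [folklore] -/
theorem toHomUnits_rho_gexp {X : Matrix (Fin 𝔊.N) (Fin 𝔊.N) ℂ} (hX : X ∈ 𝔊.lie) (t : ℝ) :
    𝔊.ρ.toHomUnits (gexp 𝔊 hX t) = expUnit (((t : ℝ) : ℂ) • X) :=
  Units.ext (by rw [MonoidHom.coe_toHomUnits, rho_gexp, val_expUnit])

/-- **`gexp` is a one-parameter subgroup**: `gexp s · gexp t = gexp (s + t)`. [folklore] -/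
theorem gexp_add {X : Matrix (Fin 𝔊.N) (Fin 𝔊.N) ℂ} (hX : X ∈ 𝔊.lie) (s t : ℝ) :
    gexp 𝔊 hX s * gexp 𝔊 hX t = gexp 𝔊 hX (s + t) := by
  apply 𝔊.injective
  have h := congrArg (fun u : (Matrix (Fin 𝔊.N) (Fin 𝔊.N) ℂ)ˣ => (u : Matrix (Fin 𝔊.N) (Fin 𝔊.N) ℂ))
    (expUnit_smul_mul_expUnit_smul X s t)
  simp only [Units.val_mul, val_expUnit] at h
  rw [map_mul, rho_gexp, rho_gexp, rho_gexp, h]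

/-- `(gexp t)⁻¹ = gexp (−t)`. [folklore] -/
theorem gexp_inv {X : Matrix (Fin 𝔊.N) (Fin 𝔊.N) ℂ} (hX : X ∈ 𝔊.lie) (t : ℝ) : (gexp 𝔊 hX t)⁻¹ = gexp 𝔊 hX (-t) := by
  rw [inv_eq_iff_mul_eq_one, gexp_add, add_neg_cancel]
  apply 𝔊.injective
  rw [rho_gexp, map_one, Complex.ofReal_zero, zero_smul, exp_zero]

/-- **THE TORUS CONFIGURATION OF A REAL ONE-FORM**: `b ↦ gexp (a b)` on the bonds of `T_η`. [cite: Balaban1985UV3, p.256 (configurations on T_ε)] -/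
def gexpCfg {X : Matrix (Fin 𝔊.N) (Fin 𝔊.N) ℂ} (hX : X ∈ 𝔊.lie) (a : PBond S.P 0 → ℝ) : GaugeField S.P 0 G :=
  fun b => gexp 𝔊 hX (a b)

/-- **ITS LIFT IS THE ABELIAN CONFIGURATION of the periodised one-form** `(y, κ) ↦ a ⟨proj y, κ⟩`. [cite: Balaban1985UV3, p.256] -/
theorem liftCfg_gexpCfg {X : Matrix (Fin 𝔊.N) (Fin 𝔊.N) ℂ} (hX : X ∈ 𝔊.lie) (a : PBond S.P 0 → ℝ) :
    liftCfg 𝔊 (gexpCfg 𝔊 hX a) = abelCfg X (fun y κ => a ⟨projSite y, κ⟩) := by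
  funext y κ
  exact toHomUnits_rho_gexp 𝔊 hX _

/-- **ITS PLAQUETTE VARIABLES ARE `gexp` OF THE LATTICE CURL**: `U(∂p) = gexp(a(x,μ) + a(x+e_μ,ν) − a(x+e_ν,μ) − a(x,ν))`.
[cite: Balaban1985Averaging, (9) p.19] -/
theorem plaqHol_gexpCfg {X : Matrix (Fin 𝔊.N) (Fin 𝔊.N) ℂ} (hX : X ∈ 𝔊.lie) (a : PBond S.P 0 → ℝ) (p : Plaq S.P 0) :
    GaugeField.plaqHol (gexpCfg 𝔊 hX a) p =
      gexp 𝔊 hX (a ⟨p.src, p.μ⟩ + a ⟨p.src.shift p.μ, p.ν⟩ - a ⟨p.src.shift p.ν, p.μ⟩ - a ⟨p.src, p.ν⟩) := by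
  simp only [GaugeField.plaqHol, gexpCfg, gexp_inv, gexp_add]
  ring_nf

/-- **THE PLAQUETTE DISTANCE `|U(∂p) − 1|` OF SUCH A CONFIGURATION IS AT MOST `|curl a(p)|·‖X‖`** (the group as printed has `dist1 = ‖ρ(·) − 1‖`).
[cite: Balaban1985Averaging, (19)+(24) p.21] -/
theorem dist1_plaqHol_gexpCfg_le {X : Matrix (Fin 𝔊.N) (Fin 𝔊.N) ℂ} (hX : X ∈ 𝔊.lie) (a : PBond S.P 0 → ℝ) (p : Plaq S.P 0) :
    dist1 (GaugeField.plaqHol (gexpCfg 𝔊 hX a) p) ≤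
      |a ⟨p.src, p.μ⟩ + a ⟨p.src.shift p.μ, p.ν⟩ - a ⟨p.src.shift p.ν, p.μ⟩ - a ⟨p.src, p.ν⟩| * ‖X‖ := by
  rw [plaqHol_gexpCfg, 𝔊.dist1_eq, UnitaryModel.opDist1, rho_gexp]
  exact norm_exp_real_smul_sub_one_le (conjTranspose_eq_neg_of_mem_lie 𝔊 hX) _

/-- … and, when `|curl a(p)|·‖X‖ ≤ π`, AT LEAST `(2/π)|curl a(p)|·‖X‖`. [cite: Balaban1985Averaging, (25) p.21] -/
theorem le_dist1_plaqHol_gexpCfg {X : Matrix (Fin 𝔊.N) (Fin 𝔊.N) ℂ} (hX : X ∈ 𝔊.lie) (a : PBond S.P 0 → ℝ) (p : Plaq S.P 0)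
    (hπ : |a ⟨p.src, p.μ⟩ + a ⟨p.src.shift p.μ, p.ν⟩ - a ⟨p.src.shift p.ν, p.μ⟩ - a ⟨p.src, p.ν⟩| * ‖X‖ ≤ Real.pi) :
    |a ⟨p.src, p.μ⟩ + a ⟨p.src.shift p.μ, p.ν⟩ - a ⟨p.src.shift p.ν, p.μ⟩ - a ⟨p.src, p.ν⟩| * ‖X‖ ≤
      Real.pi / 2 * dist1 (GaugeField.plaqHol (gexpCfg 𝔊 hX a) p) := by
  rw [plaqHol_gexpCfg, 𝔊.dist1_eq, UnitaryModel.opDist1, rho_gexp]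
  exact abs_mul_norm_le_of_exp (conjTranspose_eq_neg_of_mem_lie 𝔊 hX) hπ

end Group

end Summit.QuantumFields.YangMills.Theorems.BalabanUVNodesN08AlphaAbelianLift

end
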